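import Mathlib
import HarnessLib
import Summits.HubbardSuperconductivity.HubbardSuperconductivity.Theorems.KLProgrammeKLRegimeEngineTwoLegStepV17F2ZeroCloserSpLeg

/-!
# The scale-`0` STEP of row C2 on private rates at the registered package `klEngQ7 P R` — the `hstep0` input of
# `…EngineTwoLegSpLegStepSplitScaleZero` (cell gate-hubbard-kl, seat hubbard-kl-k3c5-p2 g7)

p1b's `abs_klLocalPart_flowFrame_zero_spLeg_le_inv` (…EngineTwoLegStepV17F2ZeroCloserSpLeg) bounds the scale-`0` spatial nested leg by `1/L₁` at the
registered thresholds; `twoLeg_scale0_hsp_klEngQ7U9` weakens it to the public quarter budget.  The private-rates induction of this lane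
(`spLeg_allScales_of_pointDefects_V17F2_rates_of_stepZero`, `spLeg_allScales_of_dualMoments_V17F2_geometric4_of_stepZero`) wants the scale-`0` step in the
form `|Δν₀| ≤ a 0 / L₁` with a PRIVATE `a 0 = d`; here it is, for every `d ≥ 1`, with the vacuous binders of STEP(0) dropped:
**`spLeg_stepZero_klEngQ7U9`**.  Proof only; no definitions; nothing about the model is asserted beyond p1b's theorem.
References: BGM 2006 §2.4 (2.23) [cite: BenfattoGiulianiMastropietro2006].
-/

noncomputable section

namespace Summit.HubbardSuperconductivity.HubbardSuperconductivity.Theorems.EngineV8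

set_option linter.dupNamespace false -- summit = problem name (single-conjunct summit), D-0017

open Real Finset Literature.MathematicalPhysics.QuantumLattice Literature.Probability.LatticeModels
open Summit.HubbardSuperconductivity.HubbardSuperconductivity.Theorems.KLProgrammeLegKernels
open Summit.HubbardSuperconductivity.HubbardSuperconductivity.Theorems.KLRegimeSplit
open Summit.HubbardSuperconductivity.HubbardSuperconductivity.Theorems.TwoVolumeDefect

/-- **THE SCALE-`0` STEP OF ROW C2 ON PRIVATE RATES, package `klEngQ7 P R`, door `klEngU₀9 P R c`**: for `R.WF`, `μ ∈ klWindowC`,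
`0 < U ≤ klEngU₀9 P R c`, `klBetaMin ≤ β`, `klEngL₃ β U ≤ L` and ANY `d ≥ 1`: for every reader threshold `Mq` (unused), all `L ≤ L₁ ∣ L₂` and every
cutoff `M₂` above both Matsubara thresholds `(klEngQ7 P R).M0 β Lᵢ`, the scale-`0` readings of the two volumes at their (zero) flow frames differ by
`≤ d / L₁` (p1b's `1/L₁`). -/
theorem spLeg_stepZero_klEngQ7U9 (P : SplitConsts) {R : RenConsts} (hR : R.WF) (c : ℝ) {μ : ℝ} (hμ : μ ∈ klWindowC) {U : ℝ}
    (hU : 0 < U) (hUle : U ≤ klEngU₀9 P R c) {β : ℝ} (hβ : klBetaMin ≤ β) {L : ℕ} (hL : klEngL₃ β U ≤ L) {d : ℝ} (hd : 1 ≤ d) :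
    ∀ (Mq : ℕ → ℕ) (L₁ L₂ M₂ : ℕ) [NeZero L₁] [NeZero L₂] [NeZero M₂], L ≤ L₁ → L₁ ∣ L₂ → (klEngQ7 P R).M0 β L₁ ≤ M₂ → Mq L₁ ≤ M₂ →
      (klEngQ7 P R).M0 β L₂ ≤ M₂ → Mq L₂ ≤ M₂ →
        ∀ θ : ℝ, |klLocalPart L₁ M₂ β U μ (klFlowFrameU L₁ M₂ β U μ 0) 0 θ -
          klLocalPart L₂ M₂ β U μ (klFlowFrameU L₂ M₂ β U μ 0) 0 θ| ≤ d / L₁ := by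
  intro Mq L₁ L₂ M₂ _ _ _ hLL₁ hdvd hM₁ _ hM₂ _ θ
  obtain ⟨b, hb⟩ := hdvd
  have hLb : L₂ = b * L₁ := by rw [hb, mul_comm]
  have hM0₁ : klEngM₃ β U L₁ ≤ M₂ := by
    have h : (klEngQ7 P R).M0 β L₁ = 2 ^ 10 * (⌈|β|⌉₊ + 1) ^ 2 * (L₁ + 1) ^ 2 := rfl
    rw [h] at hM₁; exact hM₁
  have hM0₂ : klEngM₃ β U L₂ ≤ M₂ := by
    have h : (klEngQ7 P R).M0 β L₂ = 2 ^ 10 * (⌈|β|⌉₊ + 1) ^ 2 * (L₂ + 1) ^ 2 := rfl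
    rw [h] at hM₂; exact hM₂
  have hL₁pos : (0 : ℝ) < L₁ := by exact_mod_cast Nat.pos_of_ne_zero (NeZero.ne L₁)
  have h := abs_klLocalPart_flowFrame_zero_spLeg_le_inv P hR hμ hU hUle hβ hLb (hL.trans hLL₁) hM0₁ hM0₂ θ
  exact h.trans (div_le_div_of_nonneg_right hd hL₁pos.le)

end Summit.HubbardSuperconductivity.HubbardSuperconductivity.Theorems.EngineV8

end
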